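import Summits.Ventures.PercRepro.ProfilePointedCircuitClassesStarNineSplitD

/-!
# PercRepro — THE TWO-PART SPLIT OF THE DEFECT BOUND, PART E: THE EXACT NO-KILL HYPOTHESIS, AND THE REFINED DOUBLE COUNT
(p5, gen 58; `proofs/P5-GM1.md` §86 ADD 1)

(1) Part D's no-kill hypothesis is sharpened to the pairs that matter: `f ∉ cl(A + e)` only for the pairs `A ⊆ X` with
`A + e` independent AND `X − A` a basis (`hnk'`; these are exactly the `C`-pair candidates).  (2) Without any hypothesis
on `e`, a `C`-pair lies in at most THREE first-kind defects (four points `z` with `e ∈ cl(B₀ − z)` would put `e` in the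
closure of a single point — simplicity), so the double count of part D gives, in the no-kill regime,
**`2·#tTwo ≤ 2·#cPairs + #{π ∈ cPairs : π lies in exactly three first-kind defects}`**
(`two_mul_card_tTwo_le_of_noKill`).  Hence the no-kill case of `StarNine` reduces to the bound
`#{π : three defects} ≤ 2·#fDep` (`inCount_le_of_noKill_of_triple_bound`) — a SUFFICIENT condition, not a necessary
one: the census (kit j337477) finds 4,297 no-kill instances where it fails while the first-kind bound still holds, the
slack coming from the `C`-pairs lying in no or in one defect (the exact identity `2·#tTwo = 2·#cPairs + #{π : 3}
+ #{τ : 1} − #{τ : 3} − #{π : 1} − 2·#{π : 0}`); a pair with three defects has `e` on the `3`-circuit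
`C_e(π) = {e, u, v}` of `X − π + e`, and the `fDep`-defects `{u, v, w}` are the natural payers — the per-`3`-circuit
lemma left to the successor.
-/

open scoped Matroid

namespace PercRepro.Cogirth

open Finset ThmH Skew Shadow Profile

open Classical

variable {α : Type} [DecidableEq α] {N : Matroid α} [N.Finite]

section StarNineSplitE

/-- **A FIRST-KIND DEFECT HAS AT LEAST TWO `C`-PAIRS INSIDE IT** under the exact no-kill hypothesis (`f ∉ cl(A + e)` for
the pairs `A ⊆ X` with `A + e` independent and `X − A` a basis). -/
theorem two_le_card_cPairs_subset_of_noKill' (hn : (gr N).card = 9)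
    (hcos : ∀ x ∈ gr N, ∀ y ∈ gr N, x ≠ y → rk N (((gr N).erase x).erase y) = 5) {e f : α} (he : e ∈ gr N)
    (hf : f ∈ gr N) (hef : e ≠ f)
    (hnk : ∀ A ⊆ ((gr N).erase e).erase f, A.card = 2 → rk N (insert e A) = 3 →
      rk N ((((gr N).erase e).erase f) \ A) = 5 → f ∉ clF N (insert e A))
    {τ : Finset α} (hτ : τ ∈ tTwo N e f) : 2 ≤ ((cPairs N e f).filter (fun π => π ⊆ τ)).card := by
  have hrK := rk_insert_e_sdiff_of_tTwo hn he hf hef hτ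
  have hτ' := hτ
  unfold tTwo at hτ'
  rw [mem_filter] at hτ'
  obtain ⟨hτD, _⟩ := hτ'
  obtain ⟨hτX, hτ3, hrkτe, _, hrkK, hK, _⟩ := edefect_facts hn he hf hef hτD
  have hX7 := card_X hn he hf hef
  set X := ((gr N).erase e).erase f with hXdef
  set K := X \ τ with hKdef
  have hXg : X ⊆ gr N := X_subset_gr N e f
  have hτg : τ ⊆ gr N := hτX.trans hXg
  have hKg : K ⊆ gr N := sdiff_subset.trans hXg
  have heτ : e ∉ τ := fun h => (mem_erase.1 (mem_erase.1 (hτX h)).2).1 rfl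
  have hfτ : f ∉ τ := fun h => (mem_erase.1 (hτX h)).1 rfl
  have heK : e ∉ K := fun h => (mem_erase.1 (mem_erase.1 (mem_sdiff.1 h).1).2).1 rfl
  set H := clF N K with hHdef
  have hHg : H ⊆ gr N := clF_subset_gr _
  have hH6 : H.card ≤ 6 := card_le_six_of_rk_le_four hn hcos hHg (by rw [rk_clF_eq_rk, hrkK])
  have heH : e ∈ H := by
    rw [hHdef, mem_clF_iff_rk_insert he hKg, hrK, hrkK]
  have hKeH : insert e K ⊆ H := insert_subset heH (subset_clF hKg)
  have hcard5 : (insert e K).card = 5 := by rw [card_insert_of_notMem heK, hK]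
  have hτH : τ ∩ H ⊆ H \ insert e K := by
    intro a ha
    rw [mem_inter] at ha
    rw [mem_sdiff, mem_insert, not_or]
    exact ⟨ha.2, fun h => heτ (h ▸ ha.1), fun h => (mem_sdiff.1 h).2 ha.1⟩
  have hτH1 : (τ ∩ H).card ≤ 1 := by
    have := card_le_card hτH
    rw [card_sdiff_of_subset hKeH, hcard5] at this
    omega
  have hZ : 2 ≤ (τ \ H).card := by
    have := card_sdiff_add_card_inter τ H
    omega
  refine le_trans hZ (card_le_card_of_injOn (fun z => τ.erase z) ?_ ?_)
  · intro z hz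
    rw [mem_coe, mem_sdiff] at hz
    rw [mem_coe, mem_filter]
    refine ⟨?_, erase_subset z τ⟩
    have hzg : z ∈ gr N := hτg hz.1
    have hπX : τ.erase z ⊆ X := (erase_subset _ _).trans hτX
    have hπ2 : (τ.erase z).card = 2 := by rw [card_erase_of_mem hz.1, hτ3]
    have heπ : e ∉ τ.erase z := fun h => heτ (mem_of_mem_erase h)
    have hfπ : f ∉ τ.erase z := fun h => hfτ (mem_of_mem_erase h)
    have hefπ : e ∉ insert f (τ.erase z) := by rw [mem_insert, not_or]; exact ⟨hef, heπ⟩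
    have hrkπe : rk N (insert e (τ.erase z)) = 3 := by
      have := rk_eq_card_of_subset_of_rk_eq_card (M := N)
        (insert_subset_insert e (erase_subset z τ) : insert e (τ.erase z) ⊆ insert e τ)
        (by rw [hrkτe, card_insert_of_notMem heτ, hτ3])
      rw [this, card_insert_of_notMem heπ, hπ2]
    have hzK : z ∉ K := fun h => (mem_sdiff.1 h).2 hz.1
    have hcompl : rk N (insert z K) = 5 := by
      rw [rk_insert_of_notMem_clF' hzg hKg hz.2, hrkK]
    have hXπ : X \ τ.erase z = insert z K := X_sdiff_erase_eq_insert_sdiff hτX hz.1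
    have hfcl := hnk (τ.erase z) hπX hπ2 hrkπe (by rw [hXπ, hcompl])
    have hrkπef : rk N (insert e (insert f (τ.erase z))) = 4 := by
      rw [Finset.insert_comm, rk_insert_of_notMem_clF' hf (insert_subset he (hπX.trans hXg)) hfcl, hrkπe]
    unfold cPairs
    rw [mem_filter, mem_powersetCard, mem_biIndepSets]
    refine ⟨⟨hπX, hπ2⟩, insert_subset he (insert_subset hf (hπX.trans hXg)), ?_, ?_, ?_⟩
    · rw [card_insert_of_notMem hefπ, card_insert_of_notMem hfπ, hπ2]
    · rw [hrkπef, card_insert_of_notMem hefπ, card_insert_of_notMem hfπ, hπ2]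
    · rw [gr_sdiff_insert_ef_of_subset_X hπX, hXπ, hcompl, card_insert_of_notMem hzK, hK]
  · intro z₁ hz₁ z₂ hz₂ h
    rw [mem_coe, mem_sdiff] at hz₁ hz₂
    exact (erase_inj τ hz₁.1).1 h

/-- **FOUR POINTS OF A BASIS CANNOT ALL SPAN `e`**: for an independent `5`-set `B₀` (`e ∉ B₀`) in a simple matroid, at
most three `z ∈ B₀` have `e ∈ cl(B₀ − z)`. -/
theorem card_filter_mem_clF_erase_le_three_of_five (hsimple : ∀ x ∈ gr N, ∀ y ∈ gr N, x ≠ y → rk N {x, y} = 2)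
    {e : α} (he : e ∈ gr N) {B₀ : Finset α} (hB : B₀ ⊆ gr N) (heB : e ∉ B₀) (hcard : B₀.card = 5)
    (hrk : rk N B₀ = 5) : (B₀.filter (fun z => rk N (insert e (B₀.erase z)) ≤ 4)).card ≤ 3 := by
  by_contra hcon
  rw [not_le] at hcon
  -- pick three points of the filter: `e` lies in the closure of the other two (part D), then a fourth point
  obtain ⟨z₁, z₂, z₃, h₁, h₂, h₃, h12, h13, h23⟩ :=
    two_lt_card_iff.1 (show 2 < (B₀.filter (fun z => rk N (insert e (B₀.erase z)) ≤ 4)).card by omega)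
  -- the fourth point `z₄` of the filter
  have h4 : 3 < (B₀.filter (fun z => rk N (insert e (B₀.erase z)) ≤ 4)).card := hcon
  have hsub3 : ({z₁, z₂, z₃} : Finset α) ⊆ B₀.filter (fun z => rk N (insert e (B₀.erase z)) ≤ 4) := by
    intro a ha
    rw [mem_insert, mem_insert, mem_singleton] at ha
    rcases ha with rfl | rfl | rfl <;> assumption
  have hcard3 : ({z₁, z₂, z₃} : Finset α).card = 3 := by
    rw [card_insert_of_notMem, card_pair h23]
    rw [mem_insert, mem_singleton, not_or]; exact ⟨h12, h13⟩
  obtain ⟨z₄, hz₄f, hz₄n⟩ : ∃ z₄ ∈ B₀.filter (fun z => rk N (insert e (B₀.erase z)) ≤ 4), z₄ ∉ ({z₁, z₂, z₃} : Finset α) := by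
    by_contra hno
    rw [not_exists] at hno
    have : B₀.filter (fun z => rk N (insert e (B₀.erase z)) ≤ 4) ⊆ {z₁, z₂, z₃} := by
      intro a ha
      by_contra hna
      exact hno a ⟨ha, hna⟩
    have := card_le_card this
    omega
  rw [mem_insert, mem_insert, mem_singleton, not_or, not_or] at hz₄n
  obtain ⟨h41, h42, h43⟩ : z₄ ≠ z₁ ∧ z₄ ≠ z₂ ∧ z₄ ≠ z₃ := hz₄n
  rw [mem_filter] at h₁ h₂ h₃ hz₄f
  obtain ⟨hz₁, hr₁⟩ := h₁
  obtain ⟨hz₂, hr₂⟩ := h₂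
  obtain ⟨hz₃, hr₃⟩ := h₃
  obtain ⟨hz₄, hr₄⟩ := hz₄f
  -- `ρ(e + (B₀ − z₁ − z₂)) ≤ 3`
  have hsub1 : B₀ ⊆ insert e (B₀.erase z₁) ∪ insert e (B₀.erase z₂) := by
    intro a ha
    rw [mem_union, mem_insert, mem_insert, mem_erase, mem_erase]
    by_cases haz : a = z₁
    · exact Or.inr (Or.inr ⟨haz ▸ h12, ha⟩)
    · exact Or.inl (Or.inr ⟨haz, ha⟩)
  have hI1 : insert e ((B₀.erase z₁).erase z₂) ⊆ insert e (B₀.erase z₁) ∩ insert e (B₀.erase z₂) := by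
    apply subset_inter
    · exact insert_subset_insert e (erase_subset _ _)
    · exact insert_subset_insert e (by rw [erase_right_comm]; exact erase_subset _ _)
  have hs1 := rk_union_add_rk_le_of_subset_inter (N := N) hI1
  have hu1 : 5 ≤ rk N (insert e (B₀.erase z₁) ∪ insert e (B₀.erase z₂)) := hrk ▸ rk_mono' (M := N) hsub1
  have hr12 : rk N (insert e ((B₀.erase z₁).erase z₂)) ≤ 3 := by omega
  -- `ρ(e + (B₀ − z₁ − z₂ − z₃)) ≤ 2`
  have hsub2 : B₀ ⊆ insert e (B₀.erase z₃) ∪ insert e ((B₀.erase z₁).erase z₂) := by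
    intro a ha
    rw [mem_union, mem_insert, mem_insert, mem_erase, mem_erase, mem_erase]
    by_cases haz : a = z₃
    · exact Or.inr (Or.inr ⟨haz ▸ h23.symm, haz ▸ h13.symm, ha⟩)
    · exact Or.inl (Or.inr ⟨haz, ha⟩)
  have hI2 : insert e (((B₀.erase z₁).erase z₂).erase z₃) ⊆
      insert e (B₀.erase z₃) ∩ insert e ((B₀.erase z₁).erase z₂) := by
    apply subset_inter
    · exact insert_subset_insert e (fun a ha => mem_erase.2 ⟨(mem_erase.1 ha).1,
        mem_of_mem_erase (mem_of_mem_erase (mem_erase.1 ha).2)⟩)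
    · exact insert_subset_insert e (erase_subset _ _)
  have hs2 := rk_union_add_rk_le_of_subset_inter (N := N) hI2
  have hu2 : 5 ≤ rk N (insert e (B₀.erase z₃) ∪ insert e ((B₀.erase z₁).erase z₂)) :=
    hrk ▸ rk_mono' (M := N) hsub2
  have hr123 : rk N (insert e (((B₀.erase z₁).erase z₂).erase z₃)) ≤ 2 := by omega
  -- `ρ(e + (B₀ − z₁ − z₂ − z₃ − z₄)) ≤ 1`
  have hsub3' : B₀ ⊆ insert e (B₀.erase z₄) ∪ insert e (((B₀.erase z₁).erase z₂).erase z₃) := by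
    intro a ha
    rw [mem_union, mem_insert, mem_insert, mem_erase, mem_erase, mem_erase, mem_erase]
    by_cases haz : a = z₄
    · exact Or.inr (Or.inr ⟨haz ▸ h43, haz ▸ h42, haz ▸ h41, ha⟩)
    · exact Or.inl (Or.inr ⟨haz, ha⟩)
  have hI3 : insert e ((((B₀.erase z₁).erase z₂).erase z₃).erase z₄) ⊆
      insert e (B₀.erase z₄) ∩ insert e (((B₀.erase z₁).erase z₂).erase z₃) := by
    apply subset_inter
    · exact insert_subset_insert e (fun a ha => mem_erase.2 ⟨(mem_erase.1 ha).1,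
        mem_of_mem_erase (mem_of_mem_erase (mem_of_mem_erase (mem_erase.1 ha).2))⟩)
    · exact insert_subset_insert e (erase_subset _ _)
  have hs3 := rk_union_add_rk_le_of_subset_inter (N := N) hI3
  have hu3 : 5 ≤ rk N (insert e (B₀.erase z₄) ∪ insert e (((B₀.erase z₁).erase z₂).erase z₃)) :=
    hrk ▸ rk_mono' (M := N) hsub3'
  have hr1234 : rk N (insert e ((((B₀.erase z₁).erase z₂).erase z₃).erase z₄)) ≤ 1 := by omega
  -- the remaining single point `w`: `ρ{e, w} = 2`
  have hcardw : ((((B₀.erase z₁).erase z₂).erase z₃).erase z₄).card = 1 := by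
    rw [card_erase_of_mem (mem_erase.2 ⟨h43, mem_erase.2 ⟨h42, mem_erase.2 ⟨h41, hz₄⟩⟩⟩),
      card_erase_of_mem (mem_erase.2 ⟨h23.symm, mem_erase.2 ⟨h13.symm, hz₃⟩⟩),
      card_erase_of_mem (mem_erase.2 ⟨h12.symm, hz₂⟩), card_erase_of_mem hz₁, hcard]
  obtain ⟨w, hw⟩ := card_eq_one.1 hcardw
  have hwB : w ∈ B₀ := by
    have : w ∈ (((B₀.erase z₁).erase z₂).erase z₃).erase z₄ := by rw [hw]; exact mem_singleton_self w
    exact mem_of_mem_erase (mem_of_mem_erase (mem_of_mem_erase (mem_of_mem_erase this)))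
  have hew : e ≠ w := fun h => heB (h ▸ hwB)
  have h2 := hsimple e he w (hB hwB) hew
  have hle : rk N ({e, w} : Finset α) ≤ rk N (insert e ((((B₀.erase z₁).erase z₂).erase z₃).erase z₄)) := by
    apply rk_mono'
    rw [hw]
  omega

/-- **A `C`-PAIR LIES IN AT MOST THREE FIRST-KIND DEFECTS** (simplicity alone). -/
theorem card_tTwo_supset_le_three (hn : (gr N).card = 9)
    (hsimple : ∀ x ∈ gr N, ∀ y ∈ gr N, x ≠ y → rk N {x, y} = 2) {e f : α} (he : e ∈ gr N) (hf : f ∈ gr N)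
    (hef : e ≠ f) {π : Finset α} (hπ : π ∈ cPairs N e f) : ((tTwo N e f).filter (fun τ => π ⊆ τ)).card ≤ 3 := by
  have hπ' := hπ
  unfold cPairs at hπ'
  rw [mem_filter, mem_powersetCard] at hπ'
  obtain ⟨⟨hπX, hπ2⟩, hπbi⟩ := hπ'
  obtain ⟨_, _, _, hπcompl⟩ := mem_biIndepSets.1 hπbi
  rw [gr_sdiff_insert_ef_of_subset_X hπX, card_sdiff_of_subset hπX, card_X hn he hf hef, hπ2] at hπcompl
  have hB5 : ((((gr N).erase e).erase f) \ π).card = 5 := by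
    rw [card_sdiff_of_subset hπX, card_X hn he hf hef, hπ2]
  have hBrk : rk N ((((gr N).erase e).erase f) \ π) = 5 := by omega
  set X := ((gr N).erase e).erase f with hXdef
  set B₀ := X \ π with hB₀
  have hXg : X ⊆ gr N := X_subset_gr N e f
  have hBg : B₀ ⊆ gr N := sdiff_subset.trans hXg
  have heB : e ∉ B₀ := fun h => (mem_erase.1 (mem_erase.1 (mem_sdiff.1 h).1).2).1 rfl
  have hsub : (tTwo N e f).filter (fun τ => π ⊆ τ) ⊆
      (B₀.filter (fun z => rk N (insert e (B₀.erase z)) ≤ 4)).image (fun z => insert z π) := by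
    intro τ hτ
    rw [mem_filter] at hτ
    obtain ⟨hτT, hπτ⟩ := hτ
    have hrK := rk_insert_e_sdiff_of_tTwo hn he hf hef hτT
    have hτT' := hτT
    unfold tTwo at hτT'
    rw [mem_filter] at hτT'
    obtain ⟨hτD, _⟩ := hτT'
    obtain ⟨hτX, hτ3, _, _, _, _, _⟩ := edefect_facts hn he hf hef hτD
    have hcard1 : (τ \ π).card = 1 := by rw [card_sdiff_of_subset hπτ, hτ3, hπ2]
    obtain ⟨z, hz⟩ := card_eq_one.1 hcard1
    have hzτπ : z ∈ τ \ π := by rw [hz]; exact mem_singleton_self z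
    have hτeq : insert z π = τ := by
      ext a
      rw [mem_insert]
      constructor
      · rintro (rfl | ha)
        · exact (mem_sdiff.1 hzτπ).1
        · exact hπτ ha
      · intro ha
        by_cases haπ : a ∈ π
        · exact Or.inr haπ
        · left
          have : a ∈ τ \ π := mem_sdiff.2 ⟨ha, haπ⟩
          rw [hz, mem_singleton] at this
          exact this
    have hzB : z ∈ B₀ := mem_sdiff.2 ⟨hτX (mem_sdiff.1 hzτπ).1, (mem_sdiff.1 hzτπ).2⟩
    have hKeq : X \ τ = B₀.erase z := by
      rw [← hτeq, hB₀]
      ext a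
      simp only [mem_sdiff, mem_erase, mem_insert, not_or]
      tauto
    rw [mem_image]
    refine ⟨z, ?_, hτeq⟩
    rw [mem_filter]
    refine ⟨hzB, ?_⟩
    rw [← hKeq, hrK]
  calc ((tTwo N e f).filter (fun τ => π ⊆ τ)).card
      ≤ ((B₀.filter (fun z => rk N (insert e (B₀.erase z)) ≤ 4)).image (fun z => insert z π)).card :=
        card_le_card hsub
    _ ≤ (B₀.filter (fun z => rk N (insert e (B₀.erase z)) ≤ 4)).card := card_image_le
    _ ≤ 3 := card_filter_mem_clF_erase_le_three_of_five hsimple he hBg heB hB5 hBrk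

/-- **THE REFINED DOUBLE COUNT**: in the no-kill regime,
`2·#tTwo ≤ 2·#cPairs + #{π ∈ cPairs : π lies in exactly three first-kind defects}`. -/
theorem two_mul_card_tTwo_le_of_noKill (hn : (gr N).card = 9)
    (hsimple : ∀ x ∈ gr N, ∀ y ∈ gr N, x ≠ y → rk N {x, y} = 2)
    (hcos : ∀ x ∈ gr N, ∀ y ∈ gr N, x ≠ y → rk N (((gr N).erase x).erase y) = 5) {e f : α} (he : e ∈ gr N)
    (hf : f ∈ gr N) (hef : e ≠ f)
    (hnk : ∀ A ⊆ ((gr N).erase e).erase f, A.card = 2 → rk N (insert e A) = 3 →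
      rk N ((((gr N).erase e).erase f) \ A) = 5 → f ∉ clF N (insert e A)) :
    2 * (tTwo N e f).card ≤ 2 * (cPairs N e f).card +
      ((cPairs N e f).filter (fun π => ((tTwo N e f).filter (fun τ => π ⊆ τ)).card = 3)).card := by
  have hdc := sum_card_bipartiteAbove_eq_sum_card_bipartiteBelow (fun (τ π : Finset α) => π ⊆ τ)
    (s := tTwo N e f) (t := cPairs N e f)
  have hlow : (tTwo N e f).card • 2 ≤
      ∑ τ ∈ tTwo N e f, (bipartiteAbove (fun τ π => π ⊆ τ) (cPairs N e f) τ).card := by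
    apply card_nsmul_le_sum
    intro τ hτ
    unfold bipartiteAbove
    exact two_le_card_cPairs_subset_of_noKill' hn hcos he hf hef hnk hτ
  -- the upper side: each `π` contributes `≤ 2`, plus `1` when it lies in three defects
  have hup : ∑ π ∈ cPairs N e f, (bipartiteBelow (fun τ π => π ⊆ τ) (tTwo N e f) π).card ≤
      ∑ π ∈ cPairs N e f, (2 + if ((tTwo N e f).filter (fun τ => π ⊆ τ)).card = 3 then 1 else 0) := by
    apply sum_le_sum
    intro π hπ
    rw [show bipartiteBelow (fun τ π => π ⊆ τ) (tTwo N e f) π = (tTwo N e f).filter (fun τ => π ⊆ τ) from rfl]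
    have h3 := card_tTwo_supset_le_three hn hsimple he hf hef hπ
    split_ifs with h
    · omega
    · omega
  rw [sum_add_distrib, sum_const, sum_boole] at hup
  rw [hdc] at hlow
  have := hlow.trans hup
  simp only [smul_eq_mul, Nat.cast_id] at this
  omega

/-- **THE NO-KILL CASE OF `StarNine` REDUCES TO THE TRIPLE BOUND**: if, in addition, the `C`-pairs lying in three
first-kind defects number at most `2·#fDep`, then (★)₉ holds at `(e, f)`. -/
theorem inCount_le_of_noKill_of_triple_bound (hn : (gr N).card = 9)
    (hsimple : ∀ x ∈ gr N, ∀ y ∈ gr N, x ≠ y → rk N {x, y} = 2)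
    (hcos : ∀ x ∈ gr N, ∀ y ∈ gr N, x ≠ y → rk N (((gr N).erase x).erase y) = 5) {e f : α} (he : e ∈ gr N)
    (hf : f ∈ gr N) (hef : e ≠ f)
    (hnk : ∀ A ⊆ ((gr N).erase e).erase f, A.card = 2 → rk N (insert e A) = 3 →
      rk N ((((gr N).erase e).erase f) \ A) = 5 → f ∉ clF N (insert e A))
    (htriple : ((cPairs N e f).filter (fun π => ((tTwo N e f).filter (fun τ => π ⊆ τ)).card = 3)).card ≤
      2 * (fDep N e f).card) :
    inCount N 4 e ≤ inCount N 4 f + thruCount N 4 {e, f} := by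
  apply starNine_of_defect_bound hef
  apply defect_bound_of_tTwo_bound hn hsimple hcos he hf hef
  have := two_mul_card_tTwo_le_of_noKill hn hsimple hcos he hf hef hnk
  omega

end StarNineSplitE

end PercRepro.Cogirth
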